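import Summits.ResolutionOfSingularities.ResolutionOfSingularities.Theorems.FrobeniusLadderFInjectiveMacaulayficationLocalBlowupInputFromCharts
import HarnessLib

/-!
# The WHOLE closed fibre of a local blowing up is NON-FULL, from chart facts: ∀-transport of `¬ FullCl p` from the Rees charts' primes over `v` to the stalks of
# `Bl_I(Spec R)` over `v`, and from there to EVERY blowing up `g : S′ → Spec 𝒪_{X,x}` along `J|_{Spec 𝒪_{X,x}}`
# (crux `FInjectiveMacaulayfication` stmt-ResolutionOfSingularities-15315, chain w45a; the ∀-twin of res-L1-w45a-stub-1's p624800 `TauFloorInputNotFull` (∃-form) and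
# p627935 `LocalBlowupInputFromCharts` (CM ∀-form); seat res-L1-w45a-stub-1 g11)

[OURS · L1 W4.5a] Support file (`--supports stmt-ResolutionOfSingularities-15315 --as helper`); replaces the role of NO printed item; NOT a statement of any
manuscript; def-free; UNCONDITIONAL; generic (`p` arbitrary). AI-written (AI review is weaker than expert review).

* §1 `fullCl_localization_of_ringEquiv` / `not_fullCl_localization_of_ringEquiv` — `FullCl p` at corresponding primes along a ring isomorphism (the
  `(P) (Q) (hPQ : P = Q.comap e)` form keeps the two localisation TYPES apart);
* §2 `not_fullCl_over_of_ringEquiv_aux`, ★ `not_fullCl_reesChart_over_of_blowupAlgebra` — from «every prime `Q` of `R[I/a]` with `𝔪_v ≤ Q ∩ R` is NON-FULL» to the same for the Rees chart `(R[It])_{(at)}`;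
* §3 ★ `not_fullCl_stalk_affineBlowup_of_charts_over` — every stalk of `Bl_I(Spec R)` over `v` is NON-FULL, from the Rees charts (`StalkChartIsoPoint`, GW (13.19));
* §4 ★★ `not_fullCl_over_closedPoint_of_isBlowup_comap_fromSpecStalk` — for every blowing up `g : S′ → Spec 𝒪_{X,x}` along `J.comap (X.fromSpecStalk x)`: if every
  point of a blowing up `B → X` along `J` over `x` is NON-FULL, then EVERY `s ∈ S′` over the closed point is NON-FULL (flat base change + uniqueness of blow-ups +
  stalk isomorphisms, as in p627935's `offFibre_regular_and_cmCl_over`).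
[folklore plumbing; cite: GortzWedhorn2020, (13.19), Prop. 13.91 (2)] [cite: StacksProject, Tag 0804; Tag 02OS]
-/

-- single-problem summit: the doubled namespace component is forced
set_option linter.dupNamespace false

noncomputable section

namespace Summit.ResolutionOfSingularities.ResolutionOfSingularities.Theorems.FInjectiveMacaulayfication.LocalBlowupBadFibreFromCharts

open CategoryTheory CategoryTheory.Limits AlgebraicGeometry TopologicalSpace IsLocalRing
open Literature.AlgebraicGeometry.Resolution
open Summit.ResolutionOfSingularities.ResolutionOfSingularities.Theorems.FInjectiveMacaulayfication
open SliceableCentre GermOfGlobalBlowup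

/-! ## §1 `FullCl` at corresponding primes along a ring isomorphism -/

/-- `FullCl p` passes from `A_P` to `B_Q` along `e : A ≃+* B` when `P = e⁻¹ Q`. [folklore transport] -/
theorem fullCl_localization_of_ringEquiv (p : ℕ) {A B : Type} [CommRing A] [CommRing B] (e : A ≃+* B) (P : Ideal A) (Q : Ideal B) [P.IsPrime] [Q.IsPrime]
    (hPQ : P = Q.comap e.toRingHom) (h : FullCl p (Localization.AtPrime P)) : FullCl p (Localization.AtPrime Q) := by
  subst hPQ
  obtain ⟨eQ⟩ := E8Char5FiModel.nonempty_ringEquiv_localization_comap e Q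
  exact WFixAtNonClosedDimTwo.fullCl_of_ringEquiv p eQ h

/-- `¬ FullCl p` passes from `A_P` to `B_Q` along `e : A ≃+* B` when `P = e⁻¹ Q`. [folklore transport] -/
theorem not_fullCl_localization_of_ringEquiv (p : ℕ) {A B : Type} [CommRing A] [CommRing B] (e : A ≃+* B) (P : Ideal A) (Q : Ideal B) [P.IsPrime] [Q.IsPrime]
    (hPQ : P = Q.comap e.toRingHom) (h : ¬ FullCl p (Localization.AtPrime P)) : ¬ FullCl p (Localization.AtPrime Q) := by
  subst hPQ
  obtain ⟨eQ⟩ := E8Char5FiModel.nonempty_ringEquiv_localization_comap e Q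
  exact fun h' => h (WFixAtNonClosedDimTwo.fullCl_of_ringEquiv p eQ.symm h')

/-! ## §2 From `R[I/a]` to the Rees chart `(R[It])_{(at)}` -/

/-- Transport form (type variables, to keep the Rees chart ring's instance paths out of unification): along `e : T ≅ B₁` over `R`, if every prime `Q` of `B₁` with
`𝔪_v ≤ Q ∩ R` is NON-FULL then so is every prime of `T` contracting to `v`. [plumbing] -/
theorem not_fullCl_over_of_ringEquiv_aux {R T B₁ : Type} [CommRing R] [CommRing T] [CommRing B₁] (φ : R →+* T) (ψ : R →+* B₁) (e : T ≃+* B₁)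
    (he : ∀ r : R, e (φ r) = ψ r) (p : ℕ) (v : Spec (.of R))
    (hbad : ∀ (Q : Ideal B₁) [Q.IsPrime], v.asIdeal ≤ Q.comap ψ → ¬ FullCl p (Localization.AtPrime Q))
    (q : PrimeSpectrum T) (hq : PrimeSpectrum.comap φ q = v) : ¬ FullCl p (Localization.AtPrime q.asIdeal) := by
  obtain ⟨Q, hQdef⟩ : ∃ Q : Ideal B₁, Q = q.asIdeal.map e.toRingHom := ⟨_, rfl⟩
  haveI hQ : Q.IsPrime := hQdef ▸ Ideal.map_isPrime_of_equiv e
  have hcomap : Q.comap e.toRingHom = q.asIdeal := by rw [hQdef]; exact Ideal.comap_map_of_bijective e.toRingHom e.bijective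
  have hover : v.asIdeal ≤ Q.comap ψ := by
    intro r hr
    rw [← hq, PrimeSpectrum.comap_asIdeal, Ideal.mem_comap, ← hcomap, Ideal.mem_comap] at hr
    rw [Ideal.mem_comap, ← he]
    exact hr
  exact fun hfull => hbad Q hover (fullCl_localization_of_ringEquiv p e q.asIdeal Q hcomap.symm hfull)

/-- ★ If every prime `Q` of `R[I/a] = blowupAlgebra I a` with `𝔪_v ≤ Q ∩ R` has a NON-FULL local ring, then so does every prime of the Rees chart `D₊(at)`
contracting to `v`. [folklore; cite: GortzWedhorn2020, (13.19)] -/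
theorem not_fullCl_reesChart_over_of_blowupAlgebra {R : Type} [CommRing R] (I : Ideal R) (a : R) (ha : a ∈ I) (p : ℕ) (v : Spec (.of R))
    (hbad : ∀ (Q : Ideal (blowupAlgebra I a)) [Q.IsPrime], v.asIdeal ≤ Q.comap (algebraMap R (blowupAlgebra I a)) → ¬ FullCl p (Localization.AtPrime Q))
    (q : PrimeSpectrum (HomogeneousLocalization.Away (reesGrading I) (reesT a ha))) (hq : PrimeSpectrum.comap (reesChartBase a ha) q = v) :
    ¬ FullCl p (Localization.AtPrime q.asIdeal) := by
  obtain ⟨e, he⟩ := ReesChartFacts.exists_reesChartEquiv I a ha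
  exact not_fullCl_over_of_ringEquiv_aux (T := HomogeneousLocalization.Away (reesGrading I) (reesT a ha)) _ _ e he p v hbad q hq

/-! ## §3 Every stalk of `Bl_I(Spec R)` over `v` is NON-FULL -/

/-- ★ **Every stalk of `Bl_I(Spec R)` over `v` is NON-FULL, from the Rees charts' primes over `v`.** Every point `y` is `awayι q` for a prime `q` of the chart ring
`(R[It])_{(xᵢt)}` of a non-zero generator, with `𝒪_{Bl,y} ≅` its local ring (`StalkChartIsoPoint`) and `π y = q ∩ R` (GW (13.19)). [folklore; cite: StacksProject, Tag 0804] -/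
theorem not_fullCl_stalk_affineBlowup_of_charts_over {R : Type} [CommRing R] {r : ℕ} (p : ℕ) (x : Fin r → R) (v : Spec (.of R))
    (hbad : ∀ i : Fin r, x i ≠ 0 → ∀ (q : PrimeSpectrum (HomogeneousLocalization.Away (reesGrading (Ideal.span (Set.range x)))
      (reesT (x i) (Ideal.subset_span (Set.mem_range_self i))))),
      PrimeSpectrum.comap (reesChartBase (x i) (Ideal.subset_span (Set.mem_range_self i))) q = v → ¬ FullCl p (Localization.AtPrime q.asIdeal))
    (y : ↥(affineBlowup (Ideal.span (Set.range x)))) (hy : (affineBlowup.π (Ideal.span (Set.range x))).base y = v) :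
    ¬ FullCl p ((affineBlowup (Ideal.span (Set.range x))).presheaf.stalk y) := by
  obtain ⟨i, q, hxi, hq, ⟨e⟩⟩ := StalkChartIsoPoint.stub_stalkChartIsoPoint R r x y
  intro hfull
  refine hbad i hxi q ?_ (WFixAtNonClosedDimTwo.fullCl_of_ringEquiv p e hfull)
  rw [← affineBlowup.π_awayι_reesT_apply (I := Ideal.span (Set.range x)) (x i) (Ideal.subset_span (Set.mem_range_self i)) q]
  change (affineBlowup.π (Ideal.span (Set.range x))).base ((Proj.awayι _ _ _ _).base q) = v
  rw [hq, hy]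

/-! ## §4 Every point of `S′` over the closed point is NON-FULL -/

/-- ★★ **THE WHOLE CLOSED FIBRE IS NON-FULL**: for every blowing up `g : S′ → Spec 𝒪_{X,x}` along `J|_{Spec 𝒪_{X,x}}`, if every point of a blowing up `B → X` along
`J` lying over `x` has a NON-FULL stalk, then EVERY point of `S′` over the closed point has a NON-FULL stalk (`S′ ≅ B ×_X Spec 𝒪_{X,x}`, stalks of the pullback are
stalks of `B`). [folklore assembly; cite: GortzWedhorn2020, Prop. 13.91 (2)] [cite: StacksProject, Tag 02OS] -/
theorem not_fullCl_over_closedPoint_of_isBlowup_comap_fromSpecStalk (p : ℕ) {X B : Scheme.{0}} (x : X) {πB : B ⟶ X} {J : X.IdealSheafData} (hB : IsBlowup πB J)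
    (hbad : ∀ b : B, πB.base b = x → ¬ FullCl p (B.presheaf.stalk b))
    {S' : Scheme.{0}} {g : S' ⟶ Spec (X.presheaf.stalk x)} (hg : IsBlowup g (J.comap (X.fromSpecStalk x))) :
    ∀ s : S', g.base s = closedPoint (X.presheaf.stalk x) → ¬ FullCl p (S'.presheaf.stalk s) := by
  haveI : Flat (X.fromSpecStalk x) := flat_fromSpecStalk X x
  have hP := hB.pullback_snd_of_flat (X.fromSpecStalk x)
  obtain ⟨e, he, -⟩ := hg.unique hP
  intro s hs hfull
  -- the point `b = fst (e s)` of `B` lies over `x`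
  have hgs : g.base s = (pullback.snd πB (X.fromSpecStalk x)).base (e.hom.base s) := by rw [← he]; rfl
  have hcond : πB.base ((pullback.fst πB (X.fromSpecStalk x)).base (e.hom.base s)) =
      (X.fromSpecStalk x).base ((pullback.snd πB (X.fromSpecStalk x)).base (e.hom.base s)) :=
    congrArg (fun φ => φ.base (e.hom.base s)) (pullback.condition (f := πB) (g := X.fromSpecStalk x))
  have hb : πB.base ((pullback.fst πB (X.fromSpecStalk x)).base (e.hom.base s)) = x := by
    rw [hcond, ← hgs, hs, Scheme.fromSpecStalk_closedPoint]
  -- stalks: `𝒪_{S′,s} ≅ 𝒪_{P, e s} ≅ 𝒪_{B, fst (e s)}`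
  haveI := isIso_stalkMap_of_flat_of_isPreimmersion e.hom s
  haveI := isIso_stalkMap_pullback_fst_fromSpecStalk πB x (e.hom.base s)
  have es : B.presheaf.stalk ((pullback.fst πB (X.fromSpecStalk x)).base (e.hom.base s)) ≃+* S'.presheaf.stalk s :=
    (asIso ((pullback.fst πB (X.fromSpecStalk x)).stalkMap (e.hom.base s))).commRingCatIsoToRingEquiv.trans
      (asIso (e.hom.stalkMap s)).commRingCatIsoToRingEquiv
  exact hbad _ hb (WFixAtNonClosedDimTwo.fullCl_of_ringEquiv p es.symm hfull)

end Summit.ResolutionOfSingularities.ResolutionOfSingularities.Theorems.FInjectiveMacaulayfication.LocalBlowupBadFibreFromCharts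

end
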